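import Summits.BirchSwinnertonDyer.BirchSwinnertonDyer.Theorems.ByReductionTypeAtTwoOrdKatoHalfAtTwoIsoZetaColemanMuSelmerSide
import Literature.NumberTheory.EllipticCurves.IwasawaAlgebraPseudoNullProofs
import HarnessLib

/-!
# Route ByReductionTypeAtTwo, crux `OrdKatoHalfAtTwoIso` (stmt-BirchSwinnertonDyer-19573), line
# `steinberg-fibre-at-two`, RE-CUT SOCKET 2 (F1μ): `μ(X(E/ℚ_∞)) = 0` DIRECTLY from a local Coleman dual pair at `2` whose
# Coleman map has a FINITE KERNEL (not necessarily injective), reciprocity and the one-class image clause — KERNEL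

Seat `cruxlead-stmt-BirchSwinnertonDyer-19573-w3` (prover WIDTH under the LEAD `cruxlead-19573`; HOME `run/shared/lean/pub/bsd-2adic/`;
`--supports` stmt-BirchSwinnertonDyer-23760 / its F1μ re-typing). HONEST FRAMING (cell bsd-2adic): BSD is not proved by any of this; the
socket and the crux are NOT proved here; ONE kernel theorem over explicit hypotheses; no definition, no named fact, no `sorry`.

WHY THIS FILE. The re-cut socket `SteinbergFibreAtTwo.HasZetaColemanMuInputsAtTwo` (p678187) and its Selmer-side door
`hasZetaColemanMuInputsAtTwo_of_localDualPair[_generators]` (p682177) put Kato's local quotient `P = 𝐇¹_s` INSIDE `Λ` — i.e. they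
need the Coleman map `col` (Prop. 17.11 at `2` on the `Γ`-tower) to be INJECTIVE. The tree's first typed reading of 17.11 at `2`
(`Kato2004.exists_zetaClass_colemanMinus_recLaw_index_two`, λ-level, conv-1) only grants a kernel «killed by powers of `2`», and the
cautious `Δ`-descent reading ((β₂)-loc) grants a FINITE kernel (`𝐇¹_loc(T′)^Δ ⧸ res 𝐇¹_{loc,Γ}(F⁺T)`, a finite `2`-group). For the
`μ`-ARGUMENT a finite kernel is harmless — finite `Λ`-modules are pseudo-null (tree `isPseudoNull_of_finite`) — so this
file re-runs the lead's bookkeeping `mu_eq_zero_of_hasZetaColemanMuInputsAtTwo` (p678187) on the door's hypotheses (L)(R)(E) of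
p682177 with `Function.Injective col` REPLACED by `Finite (LinearMap.ker col)`, and concludes `μ(X(E/ℚ_∞)) = 0` directly
(`mu_eq_zero_of_localDualPair_finiteKer`): INT2-AUTO gives `G₁`; socket 3 (PROVED) gives `G₁ ∉ (2)`; (E) gives ONE genuine class `g`
with `col (ℓ₀ g) = s·G₁`, `s ∉ (2)`, hence `g ∉ 2·𝐇¹`; socket 1 (PROVED, `coreTheoremATwoResidue_holds`, needs `Δ_W < 0`) kills the
`E[2]`-lifts of `Sel₀`, so `length_(2) X₀ = 0`; the transpose `τ₀` of `φ = loc₂` and the canonical fine quotient `π` are exact at `X`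
(p682177 `exact_transpose_of_ker_eq_range`), `τ₀` kills `ℓ₀ g` by (R), so `length_(2) X ≤ length_(2)(P₀ ⧸ Λ·ℓ₀ g) + 0`; and
`P₀ ⧸ Λ·ℓ₀ g → Λ ⧸ (s·G₁)` has kernel a quotient of `ker col` (FINITE ⇒ length `0` at the height-one prime `(2)`) and target of
length `0` (`s·G₁ ∉ (2)`). So the line can close `μ = 0` (hence `KatoMuPartAtTwo`, the residue binder and the crux, by the lead's
§4–§5 of p678187 with `μ = 0` in place of the socket) from the FINITE-KERNEL form of (L) if that is what the typed Kato-at-`2` fact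
delivers. Nothing is asserted about which reading is filed.

References: [Kato2004Asterisque] Thm. 12.6 (p. 222), (14.9.3) (p. 240), Lemma 17.9, Prop. 17.11 (pp. 275–277), §17.13 (pp. 279–280);
[Washington1997] §13.2; [NeukirchSchmidtWingberg2008] V §1 (5.1.4) Remark 4 (finite ⇒ pseudo-null); tree p678187, p682177,
`Kato2004/ZetaColemanMinusAtTwo.lean`, `IwasawaAlgebraPseudoNullProofs.lean`.
-/

set_option autoImplicit false
set_option linter.dupNamespace false

noncomputable section

open scoped Classical MatrixGroups ModularForm NumberField
open CongruenceSubgroup WeierstrassCurve Field IsDedekindDomain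
open Literature.NumberTheory.GaloisRepresentations
open Literature.NumberTheory.EllipticCurves Literature.NumberTheory.EllipticCurves.ModularForms
open Literature.NumberTheory.EllipticCurves.Kato2004
  Literature.NumberTheory.EllipticCurves.Kato2004.EulerSystemValues
open Literature.NumberTheory.EllipticCurves.IwasawaDual
open Literature.NumberTheory.EllipticCurves.Rank1Residual
open Summit.BirchSwinnertonDyer.BirchSwinnertonDyer.Theorems.Rank1ResidualX1Defs
  Summit.BirchSwinnertonDyer.BirchSwinnertonDyer.Rank1Residual
open Summit.BirchSwinnertonDyer.Rank1Residual Summit.BirchSwinnertonDyer.Rank1Residual.X5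
open Summit.BirchSwinnertonDyer.BirchSwinnertonDyer.Theses.ByReductionTypeAtTwo

namespace Summit.BirchSwinnertonDyer.BirchSwinnertonDyer.Theorems.SteinbergFibreAtTwo

section PerDatum

variable {W : WeierstrassCurve ℚ} [W.IsElliptic] [W.IsGloballyMinimal]
  [ContinuousSMul ℤ_[2] (W.tateModule 2)] [Module.Free ℤ_[2] (W.tateModule 2)]
  [Module.Finite ℤ_[2] (W.tateModule 2)] {N : ℕ} {f : CuspForm (Gamma0 N) 2}
  {κ : ZpExtension ℚ 2} {γ : absoluteGaloisGroup ℚ} {hκ : κ.IsCyclotomic}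

/-- **`μ(X(E/ℚ_∞)) = 0` from a local Coleman dual pair at `2` with FINITE-KERNEL Coleman map, reciprocity on generators and the
one-class image clause (KERNEL)**, for `W` good ordinary at `2`, `ρ̄_{W,2}` onto, `Δ_W < 0`, its newform `f`, cyclotomic `(κ, γ)` and
ANY Selmer dual datum `D`. Hypotheses = those of `hasZetaColemanMuInputsAtTwo_of_localDualPair_generators` (p682177) except that
`col : P₀ → Λ` is only required to have a FINITE kernel: (L) `hP : IsDualPair 2 ψ toDualP` on an abstract `P₀` against `S`,
`φ : Sel → S` intertwining `conj_γ − 1`/`ψ` with `ker φ = Sel₀`, `col` with `Finite (ker col)`; (R) `toDualP (ℓ₀ g) (φ s) = 0` for the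
members `g` of a set `G` of GENUINE `2`-adic classes; (E) for every integral lift `G₁` of `L₂(f, α)` some `g ∈ G` and `s ∉ (2)` with
`col (ℓ₀ g) = s·G₁`. Proof = the lead's `mu_eq_zero_of_hasZetaColemanMuInputsAtTwo` with `length_(2)(P₀ ⧸ Λℓ₀g) ≤
length_(2)(a quotient of ker col) + length_(2)(Λ ⧸ (s·G₁)) = 0 + 0` (finite ⇒ pseudo-null; `s·G₁ ∉ (2)`).
[cite: Kato2004Asterisque, Thm. 12.6 (p. 222), (14.9.3) (p. 240), Prop. 17.11 (p. 277), §17.13 (pp. 279–280)]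
[cite: NeukirchSchmidtWingberg2008, Ch. V §1, (5.1.4) Remark 4] -/
theorem mu_eq_zero_of_localDualPair_finiteKer [NeZero N] (hgo : GoodOrd W 2) (h2 : W.HasSurjectiveModNGaloisRep 2)
    (hΔ : W.Δ < 0) (hf : IsNewformOf W f) (hγ : κ.IsTopGenerator γ) (D : W.SelmerDualData κ γ)
    (I : IwasawaH1Data W 2 κ γ) (G : Set I.H) (hG : ∀ g ∈ G, IsEulerSystemClassTwo W hκ I g)
    {P₀ : Type*} [AddCommGroup P₀] [Module (IwasawaAlgebra 2) P₀] {S : Type*} [AddCommGroup S]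
    {ψ : AddMonoid.End S} {toDualP : P₀ →+ (S →+ AddCircle (1 : ℚ))} (hP : IsDualPair 2 ψ toDualP)
    (col : P₀ →ₗ[IwasawaAlgebra 2] IwasawaAlgebra 2) (hcol : Finite (LinearMap.ker col))
    (φ : W.selmerInfty κ →+ S) (hφ : ∀ s, φ ((W.conjSelmerInfty κ γ - 1) s) = ψ (φ s))
    (hker : ∀ s : W.selmerInfty κ, φ s = 0 ↔ (s : W.subgroupH1 2 κ.kerSubgroup) ∈ W.fineSelmerInfty κ)
    (ℓ₀ : I.H →ₗ[IwasawaAlgebra 2] P₀)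
    (hrecG : ∀ g ∈ G, ∀ s : W.selmerInfty κ, toDualP (ℓ₀ g) (φ s) = 0)
    (himgG : ∀ G₁ : IwasawaAlgebra 2,
      iwasawaToPowerSeries 2 G₁ = padicLFunction f (unitRoot W 2 : ℚ_[2]) →
        ∃ g ∈ G, ∃ s : IwasawaAlgebra 2, s ∉ IwasawaAlgebra.augIdealP 2 ∧ col (ℓ₀ g) = s * G₁) :
    D.mu = 0 := by
  have hord : IsOrdinaryAt W 2 := ⟨hgo.1, hgo.2⟩
  haveI : NeZero ((2 : ℕ) : ℚ) := ⟨by norm_num⟩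
  haveI : Module.Finite (IwasawaAlgebra 2) D.X :=
    WeierstrassCurve.SelmerDualData.module_finite_of_isCyclotomic W κ hκ D hγ
  obtain ⟨Y⟩ := W.nonempty_fineSelmerDualData κ hγ
  -- the transpose `τ₀` of `φ = loc₂` and the canonical fine quotient `π`, exact at `X`
  obtain ⟨τ₀, hτ₀⟩ := hP.exists_linearMap_comp (D.isDualPair' W κ) φ hφ
  obtain ⟨π, hπs, hπ⟩ := WeierstrassCurve.FineSelmerDualData.exists_linearMap_ofSelmerDual W κ D Y
  haveI : Module.Finite (IwasawaAlgebra 2) Y.X := Module.Finite.of_surjective π hπs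
  have hker' : ∀ s : W.selmerInfty κ,
      φ s = 0 ↔ s ∈ (AddSubgroup.inclusion (W.fineSelmerInfty_le_selmerInfty κ)).range := by
    intro s
    rw [hker, AddMonoidHom.mem_range]
    constructor
    · intro hs
      exact ⟨⟨(s : W.subgroupH1 2 κ.kerSubgroup), hs⟩, Subtype.ext rfl⟩
    · rintro ⟨s₀, rfl⟩
      exact s₀.2
  have hexact : Function.Exact τ₀ π :=
    exact_transpose_of_ker_eq_range D.bijective Y.bijective.1 hP.bijective.2
      (AddSubgroup.inclusion (W.fineSelmerInfty_le_selmerInfty κ)) φ hker' hπ hτ₀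
  -- `L₂(f, α) = ι G₁` with `G₁ ∉ (2)` (INT2-AUTO + socket 3, both PROVED)
  obtain ⟨G₁, hG₁⟩ := exists_iwasawaToPowerSeries_eq_padicLFunction_two_auto (W := W) (f := f) hord hf
  have hμL : G₁ ∉ IwasawaAlgebra.augIdealP 2 :=
    not_mem_augIdealP_of_norm_coeff_eq_one hG₁
      (AnalyticMuTwo.exists_norm_coeff_padicLFunction_two_eq_one_of_surj W hgo h2 hf)
  -- (E): one genuine class with Coleman coordinate `s·G₁`, `s ∉ (2)`; hence `s·G₁ ∉ (2)` and `g ∉ 2·𝐇¹`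
  obtain ⟨g, hgG, s, hs, hgs⟩ := himgG G₁ hG₁
  have hsG : s * G₁ ∉ IwasawaAlgebra.augIdealP 2 := fun h =>
    ((IwasawaAlgebra.isPrime_augIdealP_holds 2).mem_or_mem h).elim hs hμL
  have hg2 : g ∉ IwasawaAlgebra.augIdealP 2 • (⊤ : Submodule (IwasawaAlgebra 2) I.H) := by
    intro hmem
    apply hsG
    rw [← hgs]
    have h1 : (col ∘ₗ ℓ₀) g ∈ Submodule.map (col ∘ₗ ℓ₀)
        (IwasawaAlgebra.augIdealP 2 • (⊤ : Submodule (IwasawaAlgebra 2) I.H)) := ⟨g, hmem, rfl⟩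
    rw [Submodule.map_smul''] at h1
    have h2' : (col ∘ₗ ℓ₀) g ∈
        (IwasawaAlgebra.augIdealP 2 • ⊤ : Submodule (IwasawaAlgebra 2) (IwasawaAlgebra 2)) :=
      Submodule.smul_mono le_rfl le_top h1
    rwa [Ideal.smul_eq_mul, Ideal.mul_top] at h2'
  -- socket 1 (PROVED): a power of `T` kills the `E[2]`-lifts of `Sel₀`, so `length_(2) X₀ = 0`
  obtain ⟨J, hJ⟩ := coreTheoremATwoResidue_holds W κ γ I hκ hgo.1 hgo.2 h2 hΔ hγ ⟨g, hG g hgG, hg2⟩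
  haveI : Finite (Y.X ⧸ (IwasawaAlgebra.augIdealP 2 • (⊤ : Submodule (IwasawaAlgebra 2) Y.X))) :=
    Y.finite_quotient_augIdealP_of_finite_pTorsion
      (W.finite_fineSelmerInfty_pTorsion_of_forall_iterate_eq_zero κ hγ hJ)
  let 𝔭 : PrimeSpectrum (IwasawaAlgebra 2) :=
    ⟨IwasawaAlgebra.augIdealP 2, IwasawaAlgebra.isPrime_augIdealP_holds 2⟩
  have h𝔭1 : 𝔭.asIdeal.height ≤ 1 := le_of_eq (IwasawaAlgebra.height_augIdealP_holds 2)
  have hY0 : Module.lengthAt (IwasawaAlgebra 2) Y.X 𝔭 = 0 :=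
    KatoMuSkeleton.lengthAt_eq_zero_of_finite_quotient_p (M := Y.X) 𝔭 rfl
  -- `P₀ ⧸ Λ·ℓ₀ g` maps to `X` (τ₀ kills `ℓ₀ g` by (R)), exact before `π`
  set LZ : Submodule (IwasawaAlgebra 2) P₀ := Submodule.span (IwasawaAlgebra 2) {ℓ₀ g} with hLZ
  have hle : LZ ≤ LinearMap.ker τ₀ := by
    rw [hLZ, Submodule.span_le, Set.singleton_subset_iff, SetLike.mem_coe, LinearMap.mem_ker]
    exact transpose_eq_zero_of_pairing_eq_zero D.bijective.1 φ hτ₀ (hrecG g hgG)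
  let f' : (P₀ ⧸ LZ) →ₗ[IwasawaAlgebra 2] D.X := LZ.liftQ τ₀ hle
  have hf' : Function.Exact f' π := by
    rw [LinearMap.exact_iff, Submodule.range_liftQ]
    exact LinearMap.exact_iff.mp hexact
  -- `length_(2) (P₀ ⧸ Λ·ℓ₀ g) = 0`: it maps to `Λ ⧸ (s·G₁)` (length `0`) with kernel a quotient of `ker col` (finite)
  have hPLZ : Module.lengthAt (IwasawaAlgebra 2) (P₀ ⧸ LZ) 𝔭 = 0 := by
    set M : Ideal (IwasawaAlgebra 2) := Submodule.map col LZ with hM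
    have hsGM : s * G₁ ∈ M := by
      rw [hM, ← hgs]
      exact ⟨ℓ₀ g, Submodule.subset_span rfl, rfl⟩
    have hnot : ¬ M ≤ 𝔭.asIdeal := fun hle' => hsG (hle' hsGM)
    have hΛM : Module.lengthAt (IwasawaAlgebra 2) (IwasawaAlgebra 2 ⧸ M) 𝔭 = 0 :=
      Module.lengthAt_quotient_eq_zero_of_not_le hnot
    let colQ : (P₀ ⧸ LZ) →ₗ[IwasawaAlgebra 2] (IwasawaAlgebra 2 ⧸ M) :=
      Submodule.mapQ LZ M col fun y hy => ⟨y, hy, rfl⟩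
    -- the kernel of `colQ` lies in the image of `ker col`
    have hkerle : LinearMap.ker colQ ≤ Submodule.map LZ.mkQ (LinearMap.ker col) := by
      intro q hq
      obtain ⟨x, rfl⟩ := LZ.mkQ_surjective q
      rw [LinearMap.mem_ker, Submodule.mkQ_apply, Submodule.mapQ_apply, Submodule.Quotient.mk_eq_zero, hM] at hq
      obtain ⟨y, hy, hyx⟩ := Submodule.mem_map.1 hq
      have hy0 : LZ.mkQ y = 0 := (Submodule.Quotient.mk_eq_zero LZ).2 hy
      refine Submodule.mem_map.2 ⟨x - y, ?_, ?_⟩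
      · rw [LinearMap.mem_ker, map_sub, hyx, sub_self]
      · rw [map_sub, hy0, sub_zero]
    haveI : Finite (Submodule.map LZ.mkQ (LinearMap.ker col)) :=
      Finite.of_surjective
        (fun k : LinearMap.ker col =>
          (⟨LZ.mkQ k, k, k.2, rfl⟩ : Submodule.map LZ.mkQ (LinearMap.ker col)))
        (by
          rintro ⟨_, k, hk, rfl⟩
          exact ⟨⟨k, hk⟩, rfl⟩)
    have hK0 : Module.lengthAt (IwasawaAlgebra 2) (Submodule.map LZ.mkQ (LinearMap.ker col)) 𝔭 = 0 :=
      (Module.lengthAt_eq_zero_iff 𝔭).2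
        (isPseudoNull_of_finite 2 (Submodule.map LZ.mkQ (LinearMap.ker col)) 𝔭 h𝔭1)
    have hK0' : Module.lengthAt (IwasawaAlgebra 2) (LinearMap.ker colQ) 𝔭 = 0 :=
      le_antisymm ((Module.lengthAt_le_of_injective (Submodule.inclusion hkerle)
        (Submodule.inclusion_injective hkerle) 𝔭).trans hK0.le) bot_le
    refine le_antisymm ?_ bot_le
    calc Module.lengthAt (IwasawaAlgebra 2) (P₀ ⧸ LZ) 𝔭
        ≤ Module.lengthAt (IwasawaAlgebra 2) (LinearMap.ker colQ) 𝔭 +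
            Module.lengthAt (IwasawaAlgebra 2) (IwasawaAlgebra 2 ⧸ M) 𝔭 :=
          Module.lengthAt_le_add_of_exact _ _ (LinearMap.exact_subtype_ker_map colQ) 𝔭
      _ = 0 := by rw [hK0', hΛM, zero_add]
  -- bookkeeping at `(2)`
  have hX0 : Module.lengthAt (IwasawaAlgebra 2) D.X 𝔭 = 0 := by
    refine le_antisymm ?_ bot_le
    calc Module.lengthAt (IwasawaAlgebra 2) D.X 𝔭
        ≤ Module.lengthAt (IwasawaAlgebra 2) (P₀ ⧸ LZ) 𝔭 + Module.lengthAt (IwasawaAlgebra 2) Y.X 𝔭 :=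
          Module.lengthAt_le_add_of_exact f' π hf' 𝔭
      _ = 0 := by rw [hPLZ, hY0, zero_add]
  change muInvariant 2 D.X = 0
  rw [muInvariant_eq_toNat_lengthAt 2 D.X 𝔭 rfl, hX0]
  rfl

end PerDatum

/-! ## The habitat-level consequence: `O1.KatoMuPartAtTwo W` from a finite-kernel supply of (L)(R)(E) -/

section Habitat

variable (W : WeierstrassCurve ℚ) [W.IsElliptic] [W.IsGloballyMinimal]

/-- **`O1.KatoMuPartAtTwo W` from a FINITE-KERNEL supply of (L)(R)(E)** on the habitat «good ordinary at `2`, `ρ̄₂` onto,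
`Δ_W < 0`»: if for every newform `f` of `W`, cyclotomic `(κ, γ)` and Selmer dual datum `D` (under the structure binders of `T₂W`,
discharged here by tree theorems) there are the pinned `I`, a set `G` of genuine `2`-adic classes, a local Coleman dual pair
`(P₀, S, ψ, toDualP)` at `2` with a FINITE-kernel `col`, `φ = loc₂` with `ker φ = Sel₀`, `ℓ₀` with reciprocity on `G` and the
one-class image clause (the hypothesis `hS` — the `∀∃`-packaging of `mu_eq_zero_of_localDualPair_finiteKer`'s inputs; nothing
asserted about it), then every cyclotomic dual datum has `μ = 0`, so `2^{μ(X)} = 1 ∣ L₀`. With Abbes–Ullmo and Kato 17.4 (1)(2) at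
`2` this gives `X5.O1.MainConjectureLowerDivisibilityAtTwoOrd W` by the cell's
`O1.mainConjectureLowerDivisibilityAtTwoOrd_of_katoMuPartAtTwo` + `hint_two_of_abbesUllmo_of_irr`, exactly as in §4 of p678187.
Kernel; conditional on `hS` only. [cite: Kato2004Asterisque, Prop. 17.11 (p. 277), §17.13 (pp. 279–280)]
[cite: GreenbergLNM1716, Conj. 1.11 (p. 64) (shape)] -/
theorem katoMuPartAtTwo_of_localDualPairFiniteKer_supply
    (hS : ∀ [ContinuousSMul ℤ_[2] (W.tateModule 2)] [Module.Free ℤ_[2] (W.tateModule 2)]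
      [Module.Finite ℤ_[2] (W.tateModule 2)] {N : ℕ} [NeZero N] (f : CuspForm (Gamma0 N) 2)
      (κ : ZpExtension ℚ 2) (γ : absoluteGaloisGroup ℚ) (hκ : κ.IsCyclotomic),
      κ.IsTopGenerator γ → IsCyclotomicVariable 2 γ → IsNewformOf W f →
      ∀ (D : W.SelmerDualData κ γ),
        ∃ (I : IwasawaH1Data W 2 κ γ) (G : Set I.H)
          (P₀ : Type) (_ : AddCommGroup P₀) (_ : Module (IwasawaAlgebra 2) P₀)
          (S : Type) (_ : AddCommGroup S) (ψ : AddMonoid.End S) (toDualP : P₀ →+ (S →+ AddCircle (1 : ℚ)))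
          (col : P₀ →ₗ[IwasawaAlgebra 2] IwasawaAlgebra 2) (φ : W.selmerInfty κ →+ S)
          (ℓ₀ : I.H →ₗ[IwasawaAlgebra 2] P₀),
          (∀ g ∈ G, IsEulerSystemClassTwo W hκ I g) ∧ IsDualPair 2 ψ toDualP ∧ Finite (LinearMap.ker col) ∧
          (∀ s, φ ((W.conjSelmerInfty κ γ - 1) s) = ψ (φ s)) ∧
          (∀ s : W.selmerInfty κ, φ s = 0 ↔ (s : W.subgroupH1 2 κ.kerSubgroup) ∈ W.fineSelmerInfty κ) ∧
          (∀ g ∈ G, ∀ s : W.selmerInfty κ, toDualP (ℓ₀ g) (φ s) = 0) ∧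
          ∀ G₁ : IwasawaAlgebra 2,
            iwasawaToPowerSeries 2 G₁ = padicLFunction f (unitRoot W 2 : ℚ_[2]) →
              ∃ g ∈ G, ∃ s : IwasawaAlgebra 2, s ∉ IwasawaAlgebra.augIdealP 2 ∧ col (ℓ₀ g) = s * G₁)
    (hgo : GoodOrd W 2) (h2 : W.HasSurjectiveModNGaloisRep 2) (hΔ : W.Δ < 0) :
    O1.KatoMuPartAtTwo W := by
  intro κ γ hκ hγ hγ' _ _ f hf ϖ _ D L₀ _
  haveI : ContinuousSMul ℤ_[2] (W.tateModule 2) := TateModule.continuousSMul_padicInt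
  haveI : Module.Free ℤ_[2] (W.tateModule 2) := W.module_free_tateModule_holds 2
  haveI : Module.Finite ℤ_[2] (W.tateModule 2) := W.module_finite_tateModule_holds 2
  obtain ⟨I, G, P₀, instP₀, instP₀', S, instS, ψ, toDualP, col, φ, ℓ₀, hG, hP, hcol, hφ, hker, hrecG, himgG⟩ :=
    hS f κ γ hκ hγ hγ' hf D
  rw [mu_eq_zero_of_localDualPair_finiteKer hgo h2 hΔ hf hγ D I G hG hP col hcol φ hφ hker ℓ₀ hrecG himgG,
    pow_zero, map_one]
  exact one_dvd _

end Habitat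

end Summit.BirchSwinnertonDyer.BirchSwinnertonDyer.Theorems.SteinbergFibreAtTwo

end
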